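import Summits.ResolutionOfSingularities.ResolutionOfSingularities.Theorems.FrobeniusClosingPatchingRelPerfectDepthGradedPackagePowHolds
import Literature.AlgebraicGeometry.Resolution.ExceptionalDivisorProjectiveBundle
import HarnessLib

/-!
# Crux `PatchingRelPerfect` (stmt-ResolutionOfSingularities-16161), chain W5.2 — F6 initial state: the RETRACTION PAIR
# OF RINGS on the charts `Spec (S[𝔪t]_{y_j t})₀ ⊇ Spec (κ₀[T]_{T_j})₀` of `X₁ = Bl_𝔪 Spec S ⊇ E = ℙᵐ_{κ₀}`

[OURS · L1 W5.2 · rung tool] res-D-pv-055, F6 §1 INITIAL (`taylorPackageTwo`; res-L1-w52-plan-1 g7 GO 2026-08-27T08:35:38Z).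
The global retraction pair `(i : ℙᵐ_{κ₀} ⟶ X₁, r₀ : X₁ ⟶ ℙᵐ_{κ₀})`, `i ≫ r₀ = 𝟙` (`…DepthGradedRetraction`,
`…DepthGradedPackagePowHolds`), restricts over the standard charts to

* `r_j = Spec(ρ_j) : Spec (S[𝔪t]_{y_j t})₀ → Spec (κ₀[T]_{T_j})₀`, `ρ_j = Away.map (T ↦ y t) ∘ Away.map (κ₀ → S)`
  (`awayι_comp_retraction₀`, `…DepthGradedCharts`), and
* `k_j : Spec (κ₀[T]_{T_j})₀ → Spec (S[𝔪t]_{y_j t})₀`, the lift of `D₊(T_j) ↪ ℙᵐ → X₁` through the chart `D₊(y_j t)`;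

and this file proves what res-L1-w52-lead-1's G2′ (`…DepthTaylorFlagComap`) and res-D-pv-055's `coeffFlag_comap`
(`…DepthTaylorFlagRestrict`) consume: the square of `k_j` is CARTESIAN (`isPullback_chartLift`), `k_j ≫ r_j = 𝟙`
(`chartLift_comp_chartRetraction`), at ring level `φk_j ∘ ρ_j = id` (`preimage_chartLift_apply_ρ`) and
`ker φk_j = (y_j)` (`ker_preimage_chartLift`), with `y_j` a non-zero-divisor of the chart ring. Plus two generic
tools: ideal sheaves on a `Proj` agreeing on degree-one charts covering it are equal
(`Proj.eq_of_forall_comap_awayι_eq`), and the chart of a form ideal sheaf on `ℙᵐ` (`comap_awayι_formsIdealSheaf₀`).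
Fact-free. Rung tool of OUR route; nothing here is a statement of the manuscript under review; AI-written, weaker
than expert review.

## References
* R. Hartshorne, *Algebraic Geometry* (1977), II Prop. 5.11 (b), II Prop. 7.2. [Hartshorne1977]
* H. Hironaka, *Three key theorems on infinitely near singularities* (2005), Def. 9.1 (retractions). [Hironaka2005]
-/

-- `Summit.<Summit>.<Sub>.Theorems` with `Sub = Summit` (single-conjunct summit, D-0017)
set_option linter.dupNamespace false

noncomputable section

open CategoryTheory CategoryTheory.Limits AlgebraicGeometry Literature.AlgebraicGeometry.Resolution
open IsLocalRing TopologicalSpace HomogeneousLocalization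
open Literature.AlgebraicGeometry.Motives Literature.AlgebraicGeometry.Motives.ProjBaseChangeRing

-- The standard gradings of polynomial rings are `def`s in Mathlib; as in the Literature files
-- `Resolution/ExceptionalDivisorProjCharts`, `Motives/ProjBaseChangeAny` they are switched on locally.
attribute [local instance] MvPolynomial.gradedAlgebra

namespace Summit.ResolutionOfSingularities.ResolutionOfSingularities.Theorems

universe u

namespace DepthOne

/-! ## §1 Generic: ideal sheaves on `Proj A` are determined by their degree-one charts -/

/-- **Ideal sheaves on `Proj A` agreeing on every chart `Spec (A_{s_i})₀`, for degree-one elements `s_i` whose basic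
opens cover, are equal.** [cite: Hartshorne1977, II Prop. 5.11 (b)] -/
theorem Proj.eq_of_forall_comap_awayι_eq {R A : Type u} [CommRing R] [CommRing A] [Algebra R A]
    (𝒜 : ℕ → Submodule R A) [GradedAlgebra 𝒜] {ι : Type*} (s : ι → A) (hs : ∀ i, s i ∈ 𝒜 1)
    (hcov : ⨆ i, Proj.basicOpen 𝒜 (s i) = ⊤) {K₁ K₂ : (Proj 𝒜).IdealSheafData}
    (h : ∀ i, K₁.comap (Proj.awayι 𝒜 (s i) (hs i) one_pos) = K₂.comap (Proj.awayι 𝒜 (s i) (hs i) one_pos)) :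
    K₁ = K₂ := by
  have hι : ∀ i, (Proj.basicOpen 𝒜 (s i)).ι =
      (Proj.basicOpenIsoSpec 𝒜 (s i) (hs i) one_pos).hom ≫ Proj.awayι 𝒜 (s i) (hs i) one_pos := fun i =>
    ((Proj.basicOpenIsoSpec 𝒜 (s i) (hs i) one_pos).hom_inv_id_assoc _).symm
  have key : ∀ i, K₁.comap (Proj.basicOpen 𝒜 (s i)).ι = K₂.comap (Proj.basicOpen 𝒜 (s i)).ι := by
    intro i
    rw [hι i, Scheme.IdealSheafData.comap_comp, Scheme.IdealSheafData.comap_comp, h i]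
  exact le_antisymm
    (le_of_forall_comap_ι_le (fun i => Proj.basicOpen 𝒜 (s i)) hcov fun i => (key i).le)
    (le_of_forall_comap_ι_le (fun i => Proj.basicOpen 𝒜 (s i)) hcov fun i => (key i).ge)

/-- **The chart of a form ideal sheaf on `ℙᵐ_{κ₀}`**: `𝓟 = Ĩ`, `I = (P_l)_l ⊂ κ₀[T]` (forms of degree `d`), pulls back to
`Spec (κ₀[T]_{T_j})₀` as the ideal sheaf generated by the dehomogenised forms `P_l/T_jᵈ`.
[cite: Hartshorne1977, II Prop. 5.11 (b) (proof)] -/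
theorem comap_awayι_formsIdealSheaf₀ (κ₀ : Type u) [Field κ₀] (m : ℕ) (j : Fin (m + 1)) {d s : ℕ}
    (P : Fin s → MvPolynomial (Fin (m + 1)) κ₀)
    (hP : ∀ l, P l ∈ MvPolynomial.homogeneousSubmodule (Fin (m + 1)) κ₀ d) :
    (DepthTargets.formsIdealSheaf κ₀ m d P hP).comap
        (Proj.awayι (MvPolynomial.homogeneousSubmodule (Fin (m + 1)) κ₀) (MvPolynomial.X j)
          (ProjectiveSpace.X_mem j) one_pos) =
      affineBlowup.idealSheaf (Ideal.span (Set.range fun l =>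
        mk₁ (MvPolynomial.homogeneousSubmodule (Fin (m + 1)) κ₀) (ProjectiveSpace.X_mem (R := κ₀) j) d (P l)
          (hP l))) := by
  set 𝒜κ := MvPolynomial.homogeneousSubmodule (Fin (m + 1)) κ₀
  have e : ((⊤ : (Spec (.of (Away 𝒜κ (MvPolynomial.X j)))).Opens) : (Spec (.of (Away 𝒜κ (MvPolynomial.X j)))).Opens) ≤
      Proj.awayι 𝒜κ (MvPolynomial.X j) (ProjectiveSpace.X_mem j) one_pos ⁻¹ᵁ Proj.basicOpen 𝒜κ (MvPolynomial.X j) :=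
    top_le_preimage_of_opensRange_eq _ (Proj.opensRange_awayι 𝒜κ (MvPolynomial.X j) (ProjectiveSpace.X_mem j) one_pos)
  apply Scheme.IdealSheafData.ext_of_isAffine
  rw [ideal_comap_of_le (Proj.awayι 𝒜κ (MvPolynomial.X j) (ProjectiveSpace.X_mem j) one_pos)
      (DepthTargets.formsIdealSheaf κ₀ m d P hP)
      ⟨_, Proj.isAffineOpen_basicOpen 𝒜κ (MvPolynomial.X j) (ProjectiveSpace.X_mem (R := κ₀) j) one_pos⟩
      ⟨⊤, isAffineOpen_top _⟩ e,
    DepthTargets.formsIdealSheaf,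
    projIdealSheaf_ideal_basicOpen_span 𝒜κ P (fun _ => d) hP _ (ProjectiveSpace.X_mem (R := κ₀) j),
    Ideal.map_span, ← Set.range_comp, affineBlowup.idealSheaf, ideal_ofIdealTop_top, Ideal.map_span,
    ← Set.range_comp]
  congr 1
  congr 1
  funext l
  simp only [Function.comp_apply]
  exact appLE_awayι_awayToSection 𝒜κ (MvPolynomial.X j) (ProjectiveSpace.X_mem j) one_pos _ _

/-! ## §2 The retraction pair on the charts of `X₁ ⊇ E` -/

section Chart

variable {S : Type u} [CommRing S] {m : ℕ} (y : Fin (m + 1) → S)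
  (κ₀ : Type u) [Field κ₀] [Algebra κ₀ S]

local notation3 "M" => Ideal.span (Set.range y)
local notation3 "ℛ" => reesGrading (Ideal.span (Set.range y))
local notation3 "X₁" => affineBlowup (Ideal.span (Set.range y))
local notation3 "g" => affineBlowup.π (Ideal.span (Set.range y))
local notation3 "𝒜κ" => MvPolynomial.homogeneousSubmodule (Fin (m + 1)) κ₀
/-- the chart element `y_i t ∈ S[𝔪t]` (as in `…DepthGradedCharts`) -/
local notation3 "sElt" => fun (i : Fin (m + 1)) =>
  (reesPresentation y) ((mapGraded κ₀ S (Fin (m + 1))) (MvPolynomial.X i))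
/-- `r₀` written out (as in `…DepthGradedRetraction`). -/
local notation3 "R₀" => (Proj.map (reesPresentation y) (irrelevant_le_map_reesPresentation y) ≫
  Proj.map (mapGraded κ₀ S (Fin (m + 1))) (irrelevant_le_map κ₀ S (Fin (m + 1))) :
    affineBlowup (Ideal.span (Set.range y)) ⟶ ProjSpace.P m κ₀)
/-- the exceptional ideal `𝓔 = 𝔪𝒪_{X₁}` -/
local notation3 "𝓔" => (affineBlowup.idealSheaf (Ideal.span (Set.range y))).comap
  (affineBlowup.π (Ideal.span (Set.range y)))
/-- the chart `α_j : Spec (S[𝔪t]_{y_j t})₀ ↪ X₁` -/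
local notation3 "α" => fun (j : Fin (m + 1)) => Proj.awayι ℛ (sElt j) (sElt_mem y κ₀ j) one_pos
/-- the chart `β_j : Spec (κ₀[T]_{T_j})₀ ↪ ℙᵐ_{κ₀}` -/
local notation3 "β" => fun (j : Fin (m + 1)) =>
  Proj.awayι 𝒜κ (MvPolynomial.X j) (ProjectiveSpace.X_mem (R := κ₀) j) one_pos
/-- the ring map of the chart retraction `ρ_j : (κ₀[T]_{T_j})₀ → (S[𝔪t]_{y_j t})₀` -/
local notation3 "ρ" => fun (j : Fin (m + 1)) =>
  (Away.map (reesPresentation y) ((mapGraded κ₀ S (Fin (m + 1))) (MvPolynomial.X j))).comp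
    (Away.map (mapGraded κ₀ S (Fin (m + 1))) (MvPolynomial.X j))
/-- the chart retraction `r_j = Spec ρ_j` as the composite of the two `Spec(Away.map)` -/
local notation3 "rch" => fun (j : Fin (m + 1)) =>
  (Spec.map (CommRingCat.ofHom (Away.map (reesPresentation y)
      ((mapGraded κ₀ S (Fin (m + 1))) (MvPolynomial.X j)))) ≫
    Spec.map (CommRingCat.ofHom (Away.map (mapGraded κ₀ S (Fin (m + 1))) (MvPolynomial.X j))) :
    Spec (.of (Away ℛ (sElt j))) ⟶ Spec (.of (Away 𝒜κ (MvPolynomial.X j))))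

/-- `D₊(y_j t) = r₀⁻¹ D₊(T_j)`. [folklore] -/
theorem basicOpen_sElt_eq_preimage (j : Fin (m + 1)) :
    Proj.basicOpen ℛ (sElt j) = R₀ ⁻¹ᵁ Proj.basicOpen 𝒜κ (MvPolynomial.X j) := by
  rw [Scheme.Hom.comp_preimage, Proj.map_preimage_basicOpen, Proj.map_preimage_basicOpen]

/-- The chart retraction is `Spec` of `ρ_j`. [folklore] -/
theorem chartRetraction_eq_specMap (j : Fin (m + 1)) :
    (rch j) = Spec.map (CommRingCat.ofHom (ρ j)) := by
  rw [CommRingCat.ofHom_comp, Spec.map_comp]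

/-- `r_j ≫ β_j = α_j ≫ r₀`. [folklore] -/
theorem chartRetraction_comp_awayι (j : Fin (m + 1)) : (rch j) ≫ (β j) = (α j) ≫ R₀ := by
  rw [awayι_comp_retraction₀ y κ₀ j, Category.assoc]

/-- the embedding `i = (ι_E ≫ r₀)⁻¹ ≫ ι_E : ℙᵐ_{κ₀} ⟶ X₁` -/
local notation3 "i₀" => inv ((𝓔).subschemeι ≫ R₀) ≫ (𝓔).subschemeι

/-- `i ≫ r₀ = 𝟙`. [folklore] -/
theorem emb_comp_retraction₀ [IsIso ((𝓔).subschemeι ≫ R₀)] : i₀ ≫ R₀ = 𝟙 _ := by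
  rw [Category.assoc]; exact IsIso.inv_hom_id _

/-- `ker i = 𝓔`. [folklore] -/
theorem ker_emb [IsIso ((𝓔).subschemeι ≫ R₀)] : (i₀).ker = 𝓔 := by
  rw [Scheme.Hom.ker_comp_of_isIso, Scheme.IdealSheafData.ker_subschemeι]

/-- `i⁻¹ D₊(y_j t) = D₊(T_j)`. [folklore] -/
theorem emb_preimage_basicOpen [IsIso ((𝓔).subschemeι ≫ R₀)] (j : Fin (m + 1)) :
    i₀ ⁻¹ᵁ Proj.basicOpen ℛ (sElt j) = Proj.basicOpen 𝒜κ (MvPolynomial.X j) := by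
  rw [basicOpen_sElt_eq_preimage y κ₀ j, ← Scheme.Hom.comp_preimage, emb_comp_retraction₀]
  rfl

/-- The range of `D₊(T_j) ↪ ℙᵐ → X₁` lies in the chart `D₊(y_j t)`. [folklore] -/
theorem range_awayι_comp_emb_subset [IsIso ((𝓔).subschemeι ≫ R₀)] (j : Fin (m + 1)) :
    Set.range ((β j) ≫ i₀).base ⊆ Set.range (α j).base := by
  rintro _ ⟨x, rfl⟩
  have hx : (β j).base x ∈ (Proj.basicOpen 𝒜κ (MvPolynomial.X j) : Set (ProjSpace.P m κ₀)) := by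
    rw [← Proj.opensRange_awayι 𝒜κ (MvPolynomial.X j) (ProjectiveSpace.X_mem (R := κ₀) j) one_pos]
    exact ⟨x, rfl⟩
  rw [← emb_preimage_basicOpen y κ₀ j] at hx
  have hr : Set.range (α j).base = (Proj.basicOpen ℛ (sElt j) : Set X₁) := by
    rw [← Proj.opensRange_awayι ℛ (sElt j) (sElt_mem y κ₀ j) one_pos]; rfl
  rw [hr]
  exact hx

/-- **The chart lift `k_j : Spec (κ₀[T]_{T_j})₀ → Spec (S[𝔪t]_{y_j t})₀`** of `D₊(T_j) ↪ ℙᵐ → X₁` through the chart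
`D₊(y_j t)`: `k_j ≫ α_j = β_j ≫ i`. [folklore] -/
theorem chartLift_comp_awayι [IsIso ((𝓔).subschemeι ≫ R₀)] (j : Fin (m + 1)) :
    IsOpenImmersion.lift (α j) ((β j) ≫ i₀) (range_awayι_comp_emb_subset y κ₀ j) ≫ (α j) = (β j) ≫ i₀ :=
  IsOpenImmersion.lift_fac _ _ _

/-- **The chart square is cartesian**: `D₊(T_j) = i⁻¹ D₊(y_j t)`. [folklore] -/
theorem isPullback_chartLift [IsIso ((𝓔).subschemeι ≫ R₀)] (j : Fin (m + 1)) :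
    IsPullback (IsOpenImmersion.lift (α j) ((β j) ≫ i₀) (range_awayι_comp_emb_subset y κ₀ j)) (β j) (α j) i₀ := by
  refine IsOpenImmersion.isPullback _ _ _ _ (chartLift_comp_awayι y κ₀ j).symm ?_
  rw [Proj.opensRange_awayι, Proj.opensRange_awayι, emb_preimage_basicOpen]

/-- **`k_j ≫ r_j = 𝟙`** (test after the monomorphism `β_j`: `k_j ≫ r_j ≫ β_j = β_j ≫ i ≫ r₀ = β_j`). [folklore] -/
theorem chartLift_comp_chartRetraction [IsIso ((𝓔).subschemeι ≫ R₀)] (j : Fin (m + 1)) :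
    IsOpenImmersion.lift (α j) ((β j) ≫ i₀) (range_awayι_comp_emb_subset y κ₀ j) ≫ (rch j) = 𝟙 _ := by
  rw [← cancel_mono (β j), Category.assoc, chartRetraction_comp_awayι, ← Category.assoc, chartLift_comp_awayι,
    Category.assoc, emb_comp_retraction₀, Category.id_comp, Category.comp_id]

/-- **`φk_j ∘ ρ_j = id`** at ring level (`φk_j = Spec⁻¹ k_j`). [folklore] -/
theorem preimage_chartLift_apply_ρ [IsIso ((𝓔).subschemeι ≫ R₀)] (j : Fin (m + 1)) (a : Away 𝒜κ (MvPolynomial.X j)) :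
    (Spec.preimage (IsOpenImmersion.lift (α j) ((β j) ≫ i₀) (range_awayι_comp_emb_subset y κ₀ j))).hom ((ρ j) a) =
      a := by
  have h : Spec.map (CommRingCat.ofHom (ρ j) ≫
      Spec.preimage (IsOpenImmersion.lift (α j) ((β j) ≫ i₀) (range_awayι_comp_emb_subset y κ₀ j))) =
      Spec.map (𝟙 _) := by
    rw [Spec.map_comp, Spec.map_preimage, ← chartRetraction_eq_specMap, chartLift_comp_chartRetraction,
      Spec.map_id]
  have h' := Spec.map_inj.mp h
  exact congrArg (fun ψ : CommRingCat.of (Away 𝒜κ (MvPolynomial.X j)) ⟶ _ => ψ.hom a) h'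

/-- `ker k_j = (y_j)~` as ideal sheaves on the chart (`ker i = 𝓔`, the cartesian square, and `𝔪𝒪 = (y_j)` on
`D₊(y_j t)`). [folklore] -/
theorem ker_chartLift [IsIso ((𝓔).subschemeι ≫ R₀)] (j : Fin (m + 1)) :
    (IsOpenImmersion.lift (α j) ((β j) ≫ i₀) (range_awayι_comp_emb_subset y κ₀ j)).ker =
      affineBlowup.idealSheaf (Ideal.span {reesAwayBase y (sElt j) (y j)}) := by
  have hk : (IsOpenImmersion.lift (α j) ((β j) ≫ i₀) (range_awayι_comp_emb_subset y κ₀ j)).ker = (i₀).ker.comap (α j) :=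
    Scheme.IdealSheafData.ext (funext fun W => by
      rw [Scheme.ker_ideal_of_isPullback_of_isOpenImmersion _ _ _ _ (isPullback_chartLift y κ₀ j) W,
        Scheme.IdealSheafData.ideal_comap_of_isOpenImmersion])
  rw [hk, ker_emb, comap_awayι_comap_π, map_reesAwayBase_span_eq y (sElt j) (sElt_mem y κ₀ j) j (coe_sElt y κ₀ j)]

/-- **`ker φk_j = (y_j)`** at ring level. [folklore] -/
theorem ker_preimage_chartLift [IsIso ((𝓔).subschemeι ≫ R₀)] (j : Fin (m + 1)) :
    RingHom.ker (Spec.preimage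
        (IsOpenImmersion.lift (α j) ((β j) ≫ i₀) (range_awayι_comp_emb_subset y κ₀ j))).hom =
      Ideal.span {reesAwayBase y (sElt j) (y j)} := by
  have h := ker_chartLift y κ₀ j
  rw [← Spec.map_preimage (IsOpenImmersion.lift (α j) ((β j) ≫ i₀) (range_awayι_comp_emb_subset y κ₀ j))] at h
  conv_lhs at h => rw [← CommRingCat.ofHom_hom (Spec.preimage _), ker_specMap_eq_idealSheaf]
  exact le_antisymm (affineBlowup.idealSheaf_le_idealSheaf_iff.mp h.le)
    (affineBlowup.idealSheaf_le_idealSheaf_iff.mp h.ge)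


/-! ## §3 `y_j/1` is a non-zero-divisor of the chart ring -/

/-- The chart element `y_j t` (in its `Proj.map` spelling) is `reesT (y j)`. [folklore] -/
theorem sElt_eq_reesT (j : Fin (m + 1)) :
    sElt j = reesT (y j) (Ideal.subset_span ⟨j, rfl⟩ : y j ∈ M) :=
  Subtype.ext (by rw [coe_sElt y κ₀ j, coe_reesT])

/-- **`y_j/1` is a non-zero-divisor of `(S[𝔪t]_{y_j t})₀`** (Stacks 0804, through `reesChartBase_mem_nonZeroDivisors`).
[cite: StacksProject, Tag 0804] -/
theorem reesAwayBase_self_mem_nonZeroDivisors (j : Fin (m + 1)) :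
    reesAwayBase y (sElt j) (y j) ∈ nonZeroDivisors (Away ℛ (sElt j)) := by
  have h := reesChartBase_mem_nonZeroDivisors (I := M) (y j) (Ideal.subset_span ⟨j, rfl⟩)
  rw [← reesAwayBase_reesT y, ← sElt_eq_reesT y κ₀ j] at h
  exact h

/-! ## §4 The chart of the residual ideal `K = (𝓕𝒪 : 𝓘_Eᵈ) ⊔ 𝓘_E²` of a Taylor presentation -/

/-- the chart ring of a Taylor presentation: `ψ_j = eval₂ ρ_j (y_j/1) : (κ₀[T]_{T_j})₀[t] → (S[𝔪t]_{y_j t})₀` -/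
local notation3 "ψ" => fun (j : Fin (m + 1)) =>
  Polynomial.eval₂RingHom ((Away.map (reesPresentation y) ((mapGraded κ₀ S (Fin (m + 1))) (MvPolynomial.X j))).comp
    (Away.map (mapGraded κ₀ S (Fin (m + 1))) (MvPolynomial.X j))) (reesAwayBase y (sElt j) (y j))

/-- `𝓘_Eⁿ` on the chart `D₊(y_j t)` is `(y_jⁿ)~`. [folklore] -/
theorem comap_awayι_exc_pow (j : Fin (m + 1)) (n : ℕ) :
    ((𝓔) ^ n).comap (α j) = affineBlowup.idealSheaf (Ideal.span {reesAwayBase y (sElt j) (y j) ^ n}) := by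
  rw [comap_pow, comap_awayι_comap_π, map_reesAwayBase_span_eq y (sElt j) (sElt_mem y κ₀ j) j (coe_sElt y κ₀ j),
    ← idealSheaf_pow, Ideal.span_singleton_pow]

omit [Algebra κ₀ S] [Field κ₀] in
/-- `(c · w_l)_l = (c) · (w_l)_l`. [folklore] -/
theorem span_range_mul_eq {A : Type u} [CommRing A] {ι : Type*} (c : A) (w : ι → A) :
    Ideal.span (Set.range fun l => c * w l) = Ideal.span {c} * Ideal.span (Set.range w) := by
  rw [Ideal.span_mul_span', Set.singleton_mul, ← Set.range_comp]
  rfl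

omit [Algebra κ₀ S] [Field κ₀] in
/-- Changing generators modulo `(c)`: `(a_l + c·u_l)_l + (c) = (a_l)_l + (c)`. [folklore] -/
theorem span_range_add_mul_sup_span {A : Type u} [CommRing A] {ι : Type*} (a u : ι → A) (c : A) :
    Ideal.span (Set.range fun l => a l + c * u l) ⊔ Ideal.span {c} = Ideal.span (Set.range a) ⊔ Ideal.span {c} := by
  apply le_antisymm
  · refine sup_le (Ideal.span_le.mpr ?_) le_sup_right
    rintro _ ⟨l, rfl⟩
    exact add_mem (Ideal.mem_sup_left (Ideal.subset_span ⟨l, rfl⟩))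
      (Ideal.mem_sup_right (Ideal.mul_mem_right _ _ (Ideal.mem_span_singleton_self c)))
  · refine sup_le (Ideal.span_le.mpr ?_) le_sup_right
    rintro _ ⟨l, rfl⟩
    have : a l = (a l + c * u l) - c * u l := by ring
    rw [SetLike.mem_coe, this]
    exact sub_mem (Ideal.mem_sup_left (Ideal.subset_span ⟨l, rfl⟩))
      (Ideal.mem_sup_right (Ideal.mul_mem_right _ _ (Ideal.mem_span_singleton_self c)))

set_option maxHeartbeats 400000 in
/-- **The chart of the residual ideal of a Taylor presentation.** Let `f_l ∈ S` satisfy, on the chart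
`(S[𝔪t]_{y_j t})₀`, `f_l/1 = (y_j/1)ᵈ · (ψ_j q_l + (y_j/1)² u_l)` for polynomials `q_l ∈ (κ₀[T]_{T_j})₀[t]` (the Taylor
expansion to order `d + 1`) and `(f_l)𝒪_{X₁} ≤ 𝓘_Eᵈ`. Then the residual ideal `K = ((f_l)𝒪 : 𝓘_Eᵈ) ⊔ 𝓘_E²` restricts to
the chart as `(ψ_j q_l)_l + ((y_j/1)²)`. (Cancel the effective Cartier divisor `𝓘_Eᵈ|_{D₊}` = `((y_j/1)ᵈ)~`.)
[cite: GortzWedhorn2020, Prop. 13.91 (1)] [cite: KawanoueMatsuki2016, §2] -/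
theorem comap_awayι_residual [IsNoetherianRing S] (j : Fin (m + 1)) {d s : ℕ} (f : Fin s → S)
    (q : Fin s → Polynomial (Away 𝒜κ (MvPolynomial.X j))) (u : Fin s → Away ℛ (sElt j))
    (hf : ∀ l, reesAwayBase y (sElt j) (f l) =
      reesAwayBase y (sElt j) (y j) ^ d * ((ψ j) (q l) + reesAwayBase y (sElt j) (y j) ^ 2 * u l))
    (hL : (affineBlowup.idealSheaf (Ideal.span (Set.range f))).comap g ≤ (𝓔) ^ d) :
    (colon ((affineBlowup.idealSheaf (Ideal.span (Set.range f))).comap g) ((𝓔) ^ d) ⊔ (𝓔) ^ 2).comap (α j) =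
      affineBlowup.idealSheaf (Ideal.span (Set.range fun l => (ψ j) (q l)) ⊔
        Ideal.span {reesAwayBase y (sElt j) (y j) ^ 2}) := by
  haveI : IsNoetherian X₁ := isNoetherian_of_isBlowup (affineBlowup.isBlowup (M))
  have hcart : IsEffectiveCartier (𝓔) := (affineBlowup.isBlowup (M)).isEffectiveCartier
  -- the host part: cancel `𝓘_Eᵈ` on the chart
  have hfmt : (𝓔) ^ d * colon ((affineBlowup.idealSheaf (Ideal.span (Set.range f))).comap g) ((𝓔) ^ d) =
      (affineBlowup.idealSheaf (Ideal.span (Set.range f))).comap g := pow_mul_colon_eq_of_le hcart hL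
  have hfun : (⇑(reesAwayBase y (sElt j)) ∘ f) = fun l =>
      reesAwayBase y (sElt j) (y j) ^ d * ((ψ j) (q l) + reesAwayBase y (sElt j) (y j) ^ 2 * u l) :=
    funext fun l => hf l
  have hI : (Ideal.span (Set.range f)).map (reesAwayBase y (sElt j)) =
      Ideal.span {reesAwayBase y (sElt j) (y j) ^ d} *
        Ideal.span (Set.range fun l => (ψ j) (q l) + reesAwayBase y (sElt j) (y j) ^ 2 * u l) := by
    rw [Ideal.map_span, ← Set.range_comp, hfun]
    exact span_range_mul_eq (reesAwayBase y (sElt j) (y j) ^ d)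
      (fun l => (ψ j) (q l) + reesAwayBase y (sElt j) (y j) ^ 2 * u l)
  have hH : (colon ((affineBlowup.idealSheaf (Ideal.span (Set.range f))).comap g) ((𝓔) ^ d)).comap (α j) =
      affineBlowup.idealSheaf
        (Ideal.span (Set.range fun l => (ψ j) (q l) + reesAwayBase y (sElt j) (y j) ^ 2 * u l)) := by
    apply ((hcart.comap_of_isOpenImmersion (α j)).pow d).eq_of_mul_eq_mul
    rw [← comap_pow, ← comap_mul, hfmt, comap_awayι_comap_π, comap_awayι_exc_pow,
      ← affineBlowup.idealSheaf_mul, hI]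
  rw [Scheme.IdealSheafData.comap_sup, hH, comap_awayι_exc_pow, ← DepthTargets.idealSheaf_sup_eq]
  exact congrArg affineBlowup.idealSheaf
    (span_range_add_mul_sup_span (fun l => (ψ j) (q l)) u (reesAwayBase y (sElt j) (y j) ^ 2))

/-! ## §5 The Taylor expansion of a member's generators on the chart -/

/-- **Taylor expansion to order `d + 1` on the chart**: for forms `P₀ ∈ κ₀[T]_d`, `P₁ ∈ κ₀[T]_{d+1}` and
`G ∈ 𝔪^{d+2}`, the generator `f = P₀(y) + P₁(y) + G` reads on `(S[𝔪t]_{y_j t})₀` as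
`f/1 = (y_j/1)ᵈ · (ψ_j (P₀/T_jᵈ + t · P₁/T_j^{d+1}) + (y_j/1)² u)` (`y_jᵉ · (F/T_jᵉ) = F(y)`,
`reesAwayBase_pow_mul_awayMap_mk₁`, and `𝔪^{d+2}𝒪 = (y_j^{d+2})`). [cite: Cohen1946, Thm. 9]
[cite: KawanoueMatsuki2016, §2] -/
theorem exists_reesAwayBase_taylor (j : Fin (m + 1)) {d : ℕ} (P₀ P₁ : MvPolynomial (Fin (m + 1)) κ₀)
    (hP₀ : P₀ ∈ MvPolynomial.homogeneousSubmodule (Fin (m + 1)) κ₀ d)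
    (hP₁ : P₁ ∈ MvPolynomial.homogeneousSubmodule (Fin (m + 1)) κ₀ (d + 1)) (G : S) (hG : G ∈ (M) ^ (d + 2)) :
    ∃ u : Away ℛ (sElt j), reesAwayBase y (sElt j) (MvPolynomial.aeval y P₀ + MvPolynomial.aeval y P₁ + G) =
      reesAwayBase y (sElt j) (y j) ^ d *
        ((ψ j) (Polynomial.C (mk₁ 𝒜κ (ProjectiveSpace.X_mem (R := κ₀) j) d P₀ hP₀) +
            Polynomial.X * Polynomial.C (mk₁ 𝒜κ (ProjectiveSpace.X_mem (R := κ₀) j) (d + 1) P₁ hP₁)) +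
          reesAwayBase y (sElt j) (y j) ^ 2 * u) := by
  set b := reesAwayBase y (sElt j) with hb
  -- `G/1 ∈ (y_j/1)^{d+2}`
  have hG' : b G ∈ Ideal.span {b (y j) ^ (d + 2)} := by
    have h1 : b G ∈ ((M).map b) ^ (d + 2) := by
      rw [← Ideal.map_pow]; exact Ideal.mem_map_of_mem _ hG
    rwa [map_reesAwayBase_span_eq y (sElt j) (sElt_mem y κ₀ j) j (coe_sElt y κ₀ j), Ideal.span_singleton_pow] at h1
  obtain ⟨u, hu⟩ := Ideal.mem_span_singleton'.mp hG'
  refine ⟨u, ?_⟩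
  have h0 := reesAwayBase_pow_mul_awayMap_mk₁ y κ₀ j P₀ hP₀
  have h1 := reesAwayBase_pow_mul_awayMap_mk₁ y κ₀ j P₁ hP₁
  simp only [map_add, Polynomial.coe_eval₂RingHom, Polynomial.eval₂_C, Polynomial.eval₂_mul,
    Polynomial.eval₂_X, RingHom.coe_comp, Function.comp_apply]
  rw [← h0, ← h1, ← hu]
  ring

end Chart

end DepthOne

end Summit.ResolutionOfSingularities.ResolutionOfSingularities.Theorems

end
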